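import Literature.NumberTheory.Automorphic.SquareIntegrableRayCoefficientDecay   -- ★ `RayCoefficient.isHaarMeasure_map_mk_of_isCompact_center` (`mk : G → G⧸Z` is proper for compact `Z`)
import Literature.NumberTheory.Automorphic.MatrixCoefficientsProofs               -- ★ `Representation.continuous_matrixCoeff`
import HarnessLib

/-!
# Square-integrable modulo a COMPACT centre ⇒ square-integrable on `G`: the matrix coefficients are in `L²(G)`
# (Harish-Chandra 1970 Part I §1; Casselman 1995 §2.5; Deitmar–Echterhoff 2014 §1.5)

Topic `NumberTheory/Automorphic`; namespace `Representation`.  THEOREMS ONLY (no definition, no named fact, no instance, no notation, no `sorry`).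
Cell `hodgecm-mathlib`, E1 row 71 «(S1) CASSELMAN'S CRITERION IN RANK ONE» (census `CENSUS-R71-CasselmanRankOne.v1`, item (d) «DOCKING `G ⧸ Z ↦ G`»);
seat «LH6» LH6-p03 (g9).

★ `Representation.IsSquareIntegrableModCenter μZ` is the DOMINATION form of «square-integrable modulo the centre»: every smooth matrix coefficient
`c_{φ,v}(g) = φ(ρ(g) v)` (`φ ∈ Ṽ`) satisfies `‖c_{φ,v}(g)‖ ≤ f(gZ)` for some `f ∈ L²(G ⧸ Z(G), μZ)`.  When the measure on the quotient is the PUSH-FORWARD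
`μZ = (μG).map mk` of a measure `μG` on `G`, the pull-back `f ∘ mk` is in `L²(G, μG)` (change of variables) and dominates the continuous function `c_{φ,v}`
(★ `continuous_matrixCoeff`: coefficients of smooth vectors are locally constant), so **`c_{φ,v} ∈ L²(G, μG)`** (§1 `memLp_matrixCoeff_of_isSquareIntegrableModCenter_map`).
When `Z(G)` is COMPACT and `μG` is a Haar measure, `(μG).map mk` IS a Haar measure on `G ⧸ Z(G)` (★ `RayCoefficient.isHaarMeasure_map_mk_of_isCompact_center`), so a
criterion quantified over all Haar measures on `G ⧸ Z(G)` — e.g. Casselman's for `U(3)(L⁺_v)`, ★ `UnitaryGroup.U3SquareIntegrableExponents` ∕ ★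
`F0P3U3SquareIntegrableExponentsHolds.perPlace_bwd`, whose centre `E¹` is compact — delivers `MemLp (ρ.matrixCoeff φ v) 2 μG` on `G` itself (§2
`memLp_matrixCoeff_of_forall_isSquareIntegrableModCenter`), the letter `hL2` of the invariant-form road (CENSUS-R70 (F)).

HONEST LABEL: generic, count-neutral; HC_CM is proved only modulo the 7 printed citations (2 remaining: hLiu418 = stmt-HodgeConjecture-24832, h413 =
stmt-HodgeConjecture-24833) until rung 0 closes.
## References
* [HarishChandra1970] Harish-Chandra, *Harmonic analysis on reductive p-adic groups* (notes by G. van Dijk), LNM 162 (1970), Part I §1 p. 4.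
* [Casselman1995] W. Casselman, *Introduction to the theory of admissible representations of p-adic reductive groups* (draft 1995), §2.5 p. 28.
* [DeitmarEchterhoff2014] A. Deitmar, S. Echterhoff, *Principles of Harmonic Analysis*, 2nd ed. (2014), §1.5 (quotient integral formula).
-/

set_option autoImplicit false

noncomputable section

open MeasureTheory Literature.NumberTheory.Automorphic

namespace Representation

variable {G V : Type*} [Group G] [TopologicalSpace G] [IsTopologicalGroup G] [MeasurableSpace G] [BorelSpace G]
  [AddCommGroup V] [Module ℂ V] {ρ : Representation ℂ G V}
  [MeasurableSpace (G ⧸ Subgroup.center G)] [BorelSpace (G ⧸ Subgroup.center G)]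

/-! ## §1 Pull-back along `mk : G → G ⧸ Z(G)` -/

/-- **`L²` MODULO THE CENTRE FOR THE PUSH-FORWARD MEASURE ⇒ `L²` ON `G`.**  If `ρ` is smooth and square-integrable modulo the centre with respect to
`(μG).map mk`, then every smooth matrix coefficient is in `L²(G, μG)`: the dominating `f ∈ L²(G⧸Z, (μG).map mk)` pulls back to `f ∘ mk ∈ L²(G, μG)`
(`memLp_map_measure_iff`) and dominates the continuous `c_{φ,v}` (★ `continuous_matrixCoeff`). [cite: HarishChandra1970, Part I §1 p. 4]
[cite: Casselman1995, §2.5 p. 28] [cite: DeitmarEchterhoff2014, §1.5] -/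
theorem memLp_matrixCoeff_of_isSquareIntegrableModCenter_map (μG : Measure G) (hρ : ρ.IsSmooth)
    (h : ρ.IsSquareIntegrableModCenter (μG.map (QuotientGroup.mk : G → G ⧸ Subgroup.center G)))
    {φ : Module.Dual ℂ V} (hφ : φ ∈ ρ.contragredient) (v : V) : MemLp (ρ.matrixCoeff φ v) 2 μG := by
  obtain ⟨f, hf, hle⟩ := h φ hφ v
  have hmk : Measurable (QuotientGroup.mk : G → G ⧸ Subgroup.center G) := QuotientGroup.continuous_mk.measurable
  have hf' : MemLp (f ∘ (QuotientGroup.mk : G → G ⧸ Subgroup.center G)) 2 μG :=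
    (memLp_map_measure_iff hf.aestronglyMeasurable hmk.aemeasurable).1 hf
  refine hf'.of_le (ρ.continuous_matrixCoeff φ (hρ v)).aestronglyMeasurable (Filter.Eventually.of_forall fun g => ?_)
  rw [Function.comp_apply, Real.norm_eq_abs]
  exact (hle g).trans (le_abs_self _)

/-! ## §2 Compact centre: every criterion over all Haar measures on `G ⧸ Z(G)` delivers `L²(G)` -/

/-- **COMPACT CENTRE: `L²` MODULO THE CENTRE FOR EVERY HAAR MEASURE ON `G ⧸ Z(G)` ⇒ `L²(G)`.**  If `Z(G)` is compact and `ρ` (smooth) is square-integrable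
modulo the centre with respect to EVERY Haar measure on `G ⧸ Z(G)` (the shape in which ★ `UnitaryGroup.U3SquareIntegrableExponents` concludes), then for every
Haar measure `μG` on `G` every smooth matrix coefficient is in `L²(G, μG)` — §1 at the Haar measure `(μG).map mk` (★ `RayCoefficient.isHaarMeasure_map_mk_of_isCompact_center`).
[cite: HarishChandra1970, Part I §1 p. 4] [cite: Casselman1995, §2.5 p. 28] [cite: DeitmarEchterhoff2014, §1.5] -/
theorem memLp_matrixCoeff_of_forall_isSquareIntegrableModCenter [LocallyCompactSpace G] (hZ : IsCompact (Subgroup.center G : Set G))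
    (μG : Measure G) [μG.IsHaarMeasure] (hρ : ρ.IsSmooth)
    (h : ∀ (μZ : Measure (G ⧸ Subgroup.center G)) [μZ.IsHaarMeasure], ρ.IsSquareIntegrableModCenter μZ)
    {φ : Module.Dual ℂ V} (hφ : φ ∈ ρ.contragredient) (v : V) : MemLp (ρ.matrixCoeff φ v) 2 μG :=
  haveI := RayCoefficient.isHaarMeasure_map_mk_of_isCompact_center hZ μG
  memLp_matrixCoeff_of_isSquareIntegrableModCenter_map μG hρ (h _) hφ v

end Representation

end
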